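import Summits.BirchSwinnertonDyer.BirchSwinnertonDyer.Theorems.UniversalToricDescentToricKernelAtThreeDegreeOnlyTwinOfPrint

/-!
# CERTIFICATE KernelDegCert-w2g6 — the T10 (♭^deg) act is TURNKEY (width seat bsd-wall-utd-p2-w2 g6, 2026-08-28)

For the UTD pen (pss3x) and the utd-p2 LEAD. Route `UniversalToricDescent` rev 60; cruxes ♭B′ stmt-BirchSwinnertonDyer-27401
`TwinWanFrameAtThreeMultTresT`, ♭C₀_T stmt-27173 `TwinWanFrameAtThreeGoodSSApZeroT`; crux idea `degree-only-twin-clause` (utd-idea g25,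
Sketch-utd-idea-g25.lean c7bee29fac91ae50). Tree theorems used (landed this seat, std axioms, 0 sorry):
`Theorems/UniversalToricDescentDegreeOnlyTwinSqueeze.lean` (p639548) and `Theorems/UniversalToricDescentToricKernelAtThreeDegreeOnlyTwinOfPrint.lean`.

§A  the PROPOSED ITEM TEXTS, fully qualified, exactly as the pen would paste them into route.json (files turnkey/sig_*.txt of the
    seat folder; mirrored in the memo): ♭B′^deg `TwinDegreeFrameAtThreeMultTresT`, ♭C₀^deg `TwinDegreeFrameAtThreeGoodSSApZeroT`,
    package P_deg `TwinDegreeFrameAtThreeNonOrdBuckets`, kernel⁵ `ToricKernelAtThreeApZeroOddDegreeOfPrint` — the degree clause in the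
    route's own profile vocabulary (NO new definition; = ♭B′ / ♭C₀_T texts with the Wan clause `∃ k, …` replaced).
§B  CLOSERS, each `exact` one tree theorem: kernel⁵ item (`kernelDeg_proof`), the re-keyed `closes` (`closes_deg`), and the
    monotonicity closers ♭B′ → ♭B′^deg, ♭C₀_T → ♭C₀^deg, P_R → P_deg (so 27401/27173/27405 may go aside with every registered line
    still closing the new items, exactly as in acts T/R).
§C  the SAME items in the card's words (`FirstUnitIndex`, `DegreeClause`, Sketch §1–§2 verbatim) and `Iff.rfl` between the two
    spellings — so the pen may type either; the inline spelling needs no Defs module.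

Nothing asserted; no `sorry`; BSD is proved for no curve; no summit statement is proved by this seat.
-/

noncomputable section

open scoped Classical

set_option linter.dupNamespace false
set_option autoImplicit false

namespace Summit.BirchSwinnertonDyer.BirchSwinnertonDyer.Cruxes.TwinWanFrameAtThreeMultTresT.KernelDegCert

open Summit.BirchSwinnertonDyer.BirchSwinnertonDyer.Theses.UniversalToricDescent
open Summit.BirchSwinnertonDyer.BirchSwinnertonDyer.Theorems.UniversalToricDescentKernelDegreeOnlyTwin
open Summit.BirchSwinnertonDyer.BirchSwinnertonDyer.Theorems.UniversalToricDescentKernelDegreeOnlyTwinOfPrint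

/-! ## §A Proposed item texts (inline spelling) -/

/-- ♭B′^deg — PROPOSED crux text: ♭B′ 27401 VERBATIM with the rational Wan clause replaced by the degree clause. -/
def TwinDegreeFrameAtThreeMultTresT : Prop :=
  ∀ (W' : WeierstrassCurve ℚ) [W'.IsElliptic] [W'.IsGloballyMinimal] (N' : ℕ) [NeZero N'] (K : Type) [Field K] [NumberField K] (Dt' : Literature.NumberTheory.EllipticCurves.ModularForms.ModularParametrizationData W' N'), Literature.NumberTheory.EllipticCurves.Rank1Residual.Mult W' 3 → W'.HasSurjectiveModNGaloisRep 3 → W'.conductorNorm ℤ = N' → Literature.NumberTheory.EllipticCurves.IsImaginaryQuadratic K → Literature.NumberTheory.EllipticCurves.SatisfiesHeegnerHypothesis N' K → Odd (NumberField.discr K) → ¬ 3 ∣ padicValInt 3 W'.minimalDiscriminantInt → ∀ (κ : Literature.NumberTheory.EllipticCurves.ZpExtension K 3), κ.IsAnticyclotomic → ∀ (γ : Field.absoluteGaloisGroup K) [Fact (κ.IsTopGenerator γ)] (𝔭 : IsDedekindDomain.HeightOneSpectrum (NumberField.RingOfIntegers K)), ((3 : ℕ) : NumberField.RingOfIntegers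 K) ∈ 𝔭.asIdeal → 𝔭.asIdeal.ramificationIdx (NumberField.RingOfIntegers ℚ) = 1 → 𝔭.asIdeal.inertiaDeg (NumberField.RingOfIntegers ℚ) = 1 → ∀ (𝔭' : IsDedekindDomain.HeightOneSpectrum (NumberField.RingOfIntegers K)), ((3 : ℕ) : NumberField.RingOfIntegers K) ∈ 𝔭'.asIdeal → 𝔭' ≠ 𝔭 → ∀ (ι' : PadicAlgCl 3 ≃+* ℂ), Summit.BirchSwinnertonDyer.BirchSwinnertonDyer.Theorems.SchneiderFree.BranchInducesPrime 3 ι' 𝔭 → ∃ (ΩK : ℂ) (Ωp : ℂ_[3]) (L : Literature.NumberTheory.EllipticCurves.UnrSeries 3), ΩK ≠ 0 ∧ Ωp ≠ 0 ∧ Literature.NumberTheory.EllipticCurves.IsBDPLFunction ι' 𝔭 κ γ Dt'.f ΩK Ωp L ∧ (Module.IsTorsion (Literature.NumberTheory.EllipticCurves.IwasawaAlgebra 3) (Summit.BirchSwinnertonDyer.Rank1Residual.X11b.AcSelmer.XAc (W'.baseChange K) 3 κ 𝔭' ∅ γ) → ∀ (g : Literature.NumberTheory.EllipticCurves.UnrSeries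 3) (n m : ℕ), (Summit.BirchSwinnertonDyer.Rank1Residual.X11b.AcSelmer.XAc.charIdeal (W'.baseChange K) 3 κ 𝔭' ∅ γ).map (PowerSeries.map (Summit.BirchSwinnertonDyer.Rank1Residual.X11b.Halves.toUnr 3)) = Ideal.span {g} → (∀ i < n, ‖((PowerSeries.coeff i g : Literature.NumberTheory.EllipticCurves.unrIntegers 3) : ℂ_[3])‖ < 1) ∧ ‖((PowerSeries.coeff n g : Literature.NumberTheory.EllipticCurves.unrIntegers 3) : ℂ_[3])‖ = 1 → (∀ i < m, ‖((PowerSeries.coeff i L : Literature.NumberTheory.EllipticCurves.unrIntegers 3) : ℂ_[3])‖ < 1) ∧ ‖((PowerSeries.coeff m L : Literature.NumberTheory.EllipticCurves.unrIntegers 3) : ℂ_[3])‖ = 1 → m ≤ n)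

/-- ♭C₀^deg — PROPOSED crux text: ♭C₀_T 27173 VERBATIM with the rational Wan clause replaced by the degree clause. -/
def TwinDegreeFrameAtThreeGoodSSApZeroT : Prop :=
  ∀ (W' : WeierstrassCurve ℚ) [W'.IsElliptic] [W'.IsGloballyMinimal] (N' : ℕ) [NeZero N'] (K : Type) [Field K] [NumberField K] (Dt' : Literature.NumberTheory.EllipticCurves.ModularForms.ModularParametrizationData W' N'), Literature.NumberTheory.EllipticCurves.Rank1Residual.GoodSS W' 3 → W'.frobeniusTrace 3 = 0 → W'.HasSurjectiveModNGaloisRep 3 → W'.conductorNorm ℤ = N' → Literature.NumberTheory.EllipticCurves.IsImaginaryQuadratic K → Literature.NumberTheory.EllipticCurves.SatisfiesHeegnerHypothesis N' K → Odd (NumberField.discr K) → ∀ (κ : Literature.NumberTheory.EllipticCurves.ZpExtension K 3), κ.IsAnticyclotomic → ∀ (γ : Field.absoluteGaloisGroup K) [Fact (κ.IsTopGenerator γ)] (𝔭 : IsDedekindDomain.HeightOneSpectrum (NumberField.RingOfIntegers K)), ((3 : ℕ) : NumberField.RingOfIntegers K) ∈ 𝔭.asIdeal → 𝔭.asIdeal.ramificationIdx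 (NumberField.RingOfIntegers ℚ) = 1 → 𝔭.asIdeal.inertiaDeg (NumberField.RingOfIntegers ℚ) = 1 → ∀ (𝔭' : IsDedekindDomain.HeightOneSpectrum (NumberField.RingOfIntegers K)), ((3 : ℕ) : NumberField.RingOfIntegers K) ∈ 𝔭'.asIdeal → 𝔭' ≠ 𝔭 → ∀ (ι' : PadicAlgCl 3 ≃+* ℂ), Summit.BirchSwinnertonDyer.BirchSwinnertonDyer.Theorems.SchneiderFree.BranchInducesPrime 3 ι' 𝔭 → ∃ (ΩK : ℂ) (Ωp : ℂ_[3]) (L : Literature.NumberTheory.EllipticCurves.UnrSeries 3), ΩK ≠ 0 ∧ Ωp ≠ 0 ∧ Literature.NumberTheory.EllipticCurves.IsBDPLFunction ι' 𝔭 κ γ Dt'.f ΩK Ωp L ∧ (Module.IsTorsion (Literature.NumberTheory.EllipticCurves.IwasawaAlgebra 3) (Summit.BirchSwinnertonDyer.Rank1Residual.X11b.AcSelmer.XAc (W'.baseChange K) 3 κ 𝔭' ∅ γ) → ∀ (g : Literature.NumberTheory.EllipticCurves.UnrSeries 3) (n m : ℕ), (Summit.BirchSwinnertonDyer.Rank1Residual.X11b.AcSelmer.XAc.charIdeal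 (W'.baseChange K) 3 κ 𝔭' ∅ γ).map (PowerSeries.map (Summit.BirchSwinnertonDyer.Rank1Residual.X11b.Halves.toUnr 3)) = Ideal.span {g} → (∀ i < n, ‖((PowerSeries.coeff i g : Literature.NumberTheory.EllipticCurves.unrIntegers 3) : ℂ_[3])‖ < 1) ∧ ‖((PowerSeries.coeff n g : Literature.NumberTheory.EllipticCurves.unrIntegers 3) : ℂ_[3])‖ = 1 → (∀ i < m, ‖((PowerSeries.coeff i L : Literature.NumberTheory.EllipticCurves.unrIntegers 3) : ℂ_[3])‖ < 1) ∧ ‖((PowerSeries.coeff m L : Literature.NumberTheory.EllipticCurves.unrIntegers 3) : ℂ_[3])‖ = 1 → m ≤ n)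

/-- P_deg — PROPOSED support package (closes binder h3): ♭B′^deg ∧ ♭C₀^deg (replaces P_R 27405). -/
def TwinDegreeFrameAtThreeNonOrdBuckets : Prop :=
  TwinDegreeFrameAtThreeMultTresT ∧ TwinDegreeFrameAtThreeGoodSSApZeroT

/-- kernel⁵ — PROPOSED support text (closes binder hK): kernel⁗ 27389 VERBATIM with `TwinWanFrameAtThreeNonOrdBucketsTR →` ↦
`TwinDegreeFrameAtThreeNonOrdBuckets →`. -/
def ToricKernelAtThreeApZeroOddDegreeOfPrint : Prop :=
  ToricPublishedInputs → DefectTransportModThreePT → AdditiveSplitIMCInclusionAtThree → TwinMuZeroAtThree → TwinDegreeFrameAtThreeNonOrdBuckets → GoodSSApZeroTwinSupplyAtThree → PeuRamifieMultTwinResupplyAtThree → WildSplitPrintedInputsAtThree → WildSplitFrameAtThreeOddOfPrint → ToricPrintedLeavesAtThree → WildRankZeroTwistAtThree → ∀ (W : WeierstrassCurve ℚ) [W.IsElliptic] [W.IsGloballyMinimal], Summit.BirchSwinnertonDyer.Rank1Residual.Additive.ClassO6 W 3 → W.analyticRank = 1 → W.HasSurjectiveModNGaloisRep 3 → (∃ (W'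 : WeierstrassCurve ℚ) (_ : W'.IsElliptic) (_ : W'.IsGloballyMinimal), Summit.BirchSwinnertonDyer.Rank1Residual.O6.ModPCongruent W' W 3 ∧ ¬ Literature.NumberTheory.EllipticCurves.Rank1Residual.Addv W' 3 ∧ W'.HasSurjectiveModNGaloisRep 3) → Literature.NumberTheory.EllipticCurves.BSDp W 3

/-! ## §B Closers (each one tree theorem) -/

/-- kernel⁵ HOLDS: the proposed kernel item is closed by `bsdp_three_of_degreePackage_of_print`. -/
theorem kernelDeg_proof : ToricKernelAtThreeApZeroOddDegreeOfPrint := by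
  intro hF hD hA hM h3 hsupply hres hW hS hL hZ
  exact bsdp_three_of_degreePackage_of_print hF hD hA hM h3 hsupply hres hW hS hL hZ

/-- The re-keyed `closes` (P_R ↦ P_deg, kernel⁗ ↦ kernel⁵; other binders unchanged) elaborates. -/
theorem closes_deg (hF : ToricPublishedInputs) (hP : ToricDefectWallMuAtThree) (h3 : TwinDegreeFrameAtThreeNonOrdBuckets)
    (hsupply : GoodSSApZeroTwinSupplyAtThree) (hR : PeuRamifieMultTwinResupplyAtThree) (hW : WildSplitPrintedInputsAtThree)
    (hS : WildSplitFrameAtThreeOddOfPrint) (hL : ToricPrintedLeavesAtThree) (hZ : WildRankZeroTwistAtThree)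
    (hK : ToricKernelAtThreeApZeroOddDegreeOfPrint) :
    Summit.BirchSwinnertonDyer.WAllExclAddWildRankOneSurjTwin :=
  Summit.BirchSwinnertonDyer.wAllExclAddWildRankOneSurjTwin_of_forall (hK hF hP.1 hP.2.1 hP.2.2 h3 hsupply hR hW hS hL hZ)

/-- The same leaf with hK DISCHARGED (nine displayed hypotheses). -/
theorem leaf_of_degreePackage (hF : ToricPublishedInputs) (hP : ToricDefectWallMuAtThree) (h3 : TwinDegreeFrameAtThreeNonOrdBuckets)
    (hsupply : GoodSSApZeroTwinSupplyAtThree) (hR : PeuRamifieMultTwinResupplyAtThree) (hW : WildSplitPrintedInputsAtThree)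
    (hS : WildSplitFrameAtThreeOddOfPrint) (hL : ToricPrintedLeavesAtThree) (hZ : WildRankZeroTwistAtThree) :
    Summit.BirchSwinnertonDyer.WAllExclAddWildRankOneSurjTwin :=
  wAllExclAddWildRankOneSurjTwin_of_degreePackage hF hP h3 hsupply hR hW hS hL hZ

/-- MONOTONICITY closer ♭B′ 27401 ⟹ ♭B′^deg (every line on 27401 still closes the new crux). -/
theorem twinDegreeFrameAtThreeMultTresT_of_flat (h : TwinWanFrameAtThreeMultTresT) : TwinDegreeFrameAtThreeMultTresT := by
  intro W' _ _ N' _ K _ _ Dt' hm hsurj hN hK hH hodd hnd κ hκ γ _ 𝔭 h𝔭 he hf 𝔭' h𝔭' hne ι' hι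
  exact twinDegreeFrameMultTresT_of_wanFrame h W' N' K Dt' hm hsurj hN hK hH hodd hnd κ hκ γ 𝔭 h𝔭 he hf 𝔭' h𝔭' hne ι' hι

/-- MONOTONICITY closer ♭C₀_T 27173 ⟹ ♭C₀^deg. -/
theorem twinDegreeFrameAtThreeGoodSSApZeroT_of_flat (h : TwinWanFrameAtThreeGoodSSApZeroT) :
    TwinDegreeFrameAtThreeGoodSSApZeroT := by
  intro W' _ _ N' _ K _ _ Dt' hg ha hsurj hN hK hH hodd κ hκ γ _ 𝔭 h𝔭 he hf 𝔭' h𝔭' hne ι' hι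
  exact twinDegreeFrameGoodSSApZeroT_of_wanFrame h W' N' K Dt' hg ha hsurj hN hK hH hodd κ hκ γ 𝔭 h𝔭 he hf 𝔭' h𝔭' hne ι' hι

/-- MONOTONICITY closer P_R 27405 ⟹ P_deg. -/
theorem twinDegreeFrameAtThreeNonOrdBuckets_of_TR (h : TwinWanFrameAtThreeNonOrdBucketsTR) :
    TwinDegreeFrameAtThreeNonOrdBuckets :=
  ⟨twinDegreeFrameAtThreeMultTresT_of_flat h.1, twinDegreeFrameAtThreeGoodSSApZeroT_of_flat h.2⟩

/-- The OLD kernel⁗ 27389 from the NEW kernel⁵ (so nothing landed is lost by the re-keying). -/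
theorem kernelR_of_kernelDeg (hK : ToricKernelAtThreeApZeroOddDegreeOfPrint) : ToricKernelAtThreeApZeroOddDefectPTTROfPrint :=
  fun hF hD hA hM h3 hsupply hres hW hS hL hZ ↦
    hK hF hD hA hM (twinDegreeFrameAtThreeNonOrdBuckets_of_TR h3) hsupply hres hW hS hL hZ

/-! ## §C The card's words (Sketch-utd-idea-g25 §1–§2 verbatim) and the bridge -/

/-- Sketch §1 verbatim. -/
def FirstUnitIndex (F : Literature.NumberTheory.EllipticCurves.UnrSeries 3) (a : ℕ) : Prop :=
  (∀ i < a, ‖((PowerSeries.coeff i F : Literature.NumberTheory.EllipticCurves.unrIntegers 3) : ℂ_[3])‖ < 1) ∧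
    ‖((PowerSeries.coeff a F : Literature.NumberTheory.EllipticCurves.unrIntegers 3) : ℂ_[3])‖ = 1

/-- Sketch §1 verbatim. -/
def DegreeClause (I : Ideal (Literature.NumberTheory.EllipticCurves.UnrSeries 3))
    (L : Literature.NumberTheory.EllipticCurves.UnrSeries 3) : Prop :=
  ∀ (g : Literature.NumberTheory.EllipticCurves.UnrSeries 3) (n m : ℕ), I = Ideal.span {g} → FirstUnitIndex g n →
    FirstUnitIndex L m → m ≤ n

/-- Sketch §2 verbatim (card spelling of ♭B′^deg). -/
def TwinDegreeFrameAtThreeMultTresTCard : Prop :=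
  ∀ (W' : WeierstrassCurve ℚ) [W'.IsElliptic] [W'.IsGloballyMinimal] (N' : ℕ) [NeZero N'] (K : Type) [Field K] [NumberField K] (Dt' : Literature.NumberTheory.EllipticCurves.ModularForms.ModularParametrizationData W' N'), Literature.NumberTheory.EllipticCurves.Rank1Residual.Mult W' 3 → W'.HasSurjectiveModNGaloisRep 3 → W'.conductorNorm ℤ = N' → Literature.NumberTheory.EllipticCurves.IsImaginaryQuadratic K → Literature.NumberTheory.EllipticCurves.SatisfiesHeegnerHypothesis N' K → Odd (NumberField.discr K) → ¬ 3 ∣ padicValInt 3 W'.minimalDiscriminantInt → ∀ (κ : Literature.NumberTheory.EllipticCurves.ZpExtension K 3), κ.IsAnticyclotomic → ∀ (γ : Field.absoluteGaloisGroup K) [Fact (κ.IsTopGenerator γ)] (𝔭 : IsDedekindDomain.HeightOneSpectrum (NumberField.RingOfIntegers K)), ((3 : ℕ) : NumberField.RingOfIntegers K) ∈ 𝔭.asIdeal → 𝔭.asIdeal.ramificationIdx (NumberField.RingOfIntegers ℚ) = 1 → 𝔭.asIdeal.inertiaDeg (NumberField.RingOfIntegers ℚ) = 1 → ∀ (𝔭'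 : IsDedekindDomain.HeightOneSpectrum (NumberField.RingOfIntegers K)), ((3 : ℕ) : NumberField.RingOfIntegers K) ∈ 𝔭'.asIdeal → 𝔭' ≠ 𝔭 → ∀ (ι' : PadicAlgCl 3 ≃+* ℂ), Summit.BirchSwinnertonDyer.BirchSwinnertonDyer.Theorems.SchneiderFree.BranchInducesPrime 3 ι' 𝔭 → ∃ (ΩK : ℂ) (Ωp : ℂ_[3]) (L : Literature.NumberTheory.EllipticCurves.UnrSeries 3), ΩK ≠ 0 ∧ Ωp ≠ 0 ∧ Literature.NumberTheory.EllipticCurves.IsBDPLFunction ι' 𝔭 κ γ Dt'.f ΩK Ωp L ∧ (Module.IsTorsion (Literature.NumberTheory.EllipticCurves.IwasawaAlgebra 3) (Summit.BirchSwinnertonDyer.Rank1Residual.X11b.AcSelmer.XAc (W'.baseChange K) 3 κ 𝔭' ∅ γ) → DegreeClause ((Summit.BirchSwinnertonDyer.Rank1Residual.X11b.AcSelmer.XAc.charIdeal (W'.baseChange K) 3 κ 𝔭' ∅ γ).map (PowerSeries.map (Summit.BirchSwinnertonDyer.Rank1Residual.X11b.Halves.toUnr 3))) L)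

/-- Sketch §2 verbatim (card spelling of ♭C₀^deg). -/
def TwinDegreeFrameAtThreeGoodSSApZeroTCard : Prop :=
  ∀ (W' : WeierstrassCurve ℚ) [W'.IsElliptic] [W'.IsGloballyMinimal] (N' : ℕ) [NeZero N'] (K : Type) [Field K] [NumberField K] (Dt' : Literature.NumberTheory.EllipticCurves.ModularForms.ModularParametrizationData W' N'), Literature.NumberTheory.EllipticCurves.Rank1Residual.GoodSS W' 3 → W'.frobeniusTrace 3 = 0 → W'.HasSurjectiveModNGaloisRep 3 → W'.conductorNorm ℤ = N' → Literature.NumberTheory.EllipticCurves.IsImaginaryQuadratic K → Literature.NumberTheory.EllipticCurves.SatisfiesHeegnerHypothesis N' K → Odd (NumberField.discr K) → ∀ (κ : Literature.NumberTheory.EllipticCurves.ZpExtension K 3), κ.IsAnticyclotomic → ∀ (γ : Field.absoluteGaloisGroup K) [Fact (κ.IsTopGenerator γ)] (𝔭 : IsDedekindDomain.HeightOneSpectrum (NumberField.RingOfIntegers K)), ((3 : ℕ) : NumberField.RingOfIntegers K) ∈ 𝔭.asIdeal → 𝔭.asIdeal.ramificationIdx (NumberField.RingOfIntegers ℚ)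 = 1 → 𝔭.asIdeal.inertiaDeg (NumberField.RingOfIntegers ℚ) = 1 → ∀ (𝔭' : IsDedekindDomain.HeightOneSpectrum (NumberField.RingOfIntegers K)), ((3 : ℕ) : NumberField.RingOfIntegers K) ∈ 𝔭'.asIdeal → 𝔭' ≠ 𝔭 → ∀ (ι' : PadicAlgCl 3 ≃+* ℂ), Summit.BirchSwinnertonDyer.BirchSwinnertonDyer.Theorems.SchneiderFree.BranchInducesPrime 3 ι' 𝔭 → ∃ (ΩK : ℂ) (Ωp : ℂ_[3]) (L : Literature.NumberTheory.EllipticCurves.UnrSeries 3), ΩK ≠ 0 ∧ Ωp ≠ 0 ∧ Literature.NumberTheory.EllipticCurves.IsBDPLFunction ι' 𝔭 κ γ Dt'.f ΩK Ωp L ∧ (Module.IsTorsion (Literature.NumberTheory.EllipticCurves.IwasawaAlgebra 3) (Summit.BirchSwinnertonDyer.Rank1Residual.X11b.AcSelmer.XAc (W'.baseChange K) 3 κ 𝔭' ∅ γ) → DegreeClause ((Summit.BirchSwinnertonDyer.Rank1Residual.X11b.AcSelmer.XAc.charIdeal (W'.baseChange K) 3 κ 𝔭' ∅ γ).map (PowerSeries.map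 (Summit.BirchSwinnertonDyer.Rank1Residual.X11b.Halves.toUnr 3))) L)

/-- The two spellings of ♭B′^deg are the same proposition (δ). -/
theorem twinDegreeFrameAtThreeMultTresT_card_iff : TwinDegreeFrameAtThreeMultTresTCard ↔ TwinDegreeFrameAtThreeMultTresT :=
  Iff.rfl

/-- The two spellings of ♭C₀^deg are the same proposition (δ). -/
theorem twinDegreeFrameAtThreeGoodSSApZeroT_card_iff :
    TwinDegreeFrameAtThreeGoodSSApZeroTCard ↔ TwinDegreeFrameAtThreeGoodSSApZeroT :=
  Iff.rfl

end Summit.BirchSwinnertonDyer.BirchSwinnertonDyer.Cruxes.TwinWanFrameAtThreeMultTresT.KernelDegCert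

end
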